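import Summits.CriticalPhenomena.SAWScalingLimit.Theorems.SAWDevelopingMapHexTransferPortTransferCompass
import Summits.CriticalPhenomena.SAWScalingLimit.Theorems.SAWDevelopingMapHexTransferPortTransferPolyline
import Summits.CriticalPhenomena.SAWScalingLimit.Theorems.SAWDevelopingMapHexTransferPortTransferWeakLimit
import Summits.CriticalPhenomena.SAWScalingLimit.Theorems.SAWDevelopingMapHexTransferCompassEndpoints
import Literature.Probability.RandomPlanarGeometry.LocalMartingaleProofs

/-!
# Port transfer: `PortDictionary → YBSquareSLE → CompassSLE` (stub `stub_portTransfer`)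

Line `Sketch` (quarter-turn pinning) for the crux `HexTransfer` (stmt-CriticalPhenomena-14221),
stub `stub_portTransfer`: under the port dictionary (item stmt-CriticalPhenomena-6966), chordal
SLE(8/3) convergence of Glazman–Manolescu's critical Yang–Baxter walk on the square tiling
(`SAWCompassLattice.YBSquareSLE`, stmt-6967) transfers to the honest compass self-avoiding walk
(`SAWCompassLattice.CompassSLE`, stmt-6965).

Part B (this file, namespace `…Sketch.PortTransfer`): **the deterministic O(δ) coupling** —
`dist_compassCurve_curve_le`: a compass path `p` of `Ω_δ` drawn at mesh `δ` (polyline through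
`δ · emb v`, `v` over the support of `p`) and GM's drawing of the Yang–Baxter walk through the same
ports in the same order are at distance `≤ |δ|` in `CurveClass ℂ`. Mechanism: between two
consecutive ports the compass path only visits gadget vertices of ONE face, of which both ports are
sides (`forall₂_support_stay`); a gadget vertex is embedded within `1/2` of the centre of its face
and a side midpoint is at distance `1/2` from it, so every vertex of the compass polyline is within
`|δ|` of the last port seen; the polyline through the ports-with-repetitions IS the YB polyline up
to reparametrisation (`mk_polyline_stay`, part B₀), and polylines with pairwise close vertices are
close (`dist_mk_polyline_le`, part B₀).

Assembly (`stub_portTransfer`, namespace `…Sketch`) of the helper files: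
* part A (`…PortTransferCompass`): the compass chordal law is the push-forward of the normalised
  compass path measure `ρ_δ` along the drawing map, and GM's law `ybLaw (π/2) Ω δ 1 a b` is the
  push-forward of the SAME `ρ_δ` along `toYB` — the port dictionary summed over the fibres of
  `toYB`; `ρ_δ` is `0` or a probability measure;
* part B (here): the two drawings of a path are at distance `≤ |δ|`;
* part C (`…PortTransferWeakLimit`): convergence in law along `δ → 0⁺` passes along such a
  coupling (bounded-Lipschitz portmanteau), the limit `Γ` being an SLE(8/3) random curve under the
  (probability, `isProbabilityMeasure_preWienerMeasure'`) pre-Wiener measure.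
Tagged [folklore].
-/

noncomputable section

namespace Summit.CriticalPhenomena.SAWScalingLimit.Cruxes.HexTransfer.Sketch

namespace PortTransfer

open MeasureTheory Filter Topology Set
open scoped ENNReal NNReal
open Literature.Probability.RandomPlanarGeometry.SAW.YangBaxter Literature.Probability.RandomPlanarGeometry
open Literature.Probability.LatticeModels (polyline)
open Summit.CriticalPhenomena.SAWScalingLimit.Theses
open Complex (I)

/-! ### The square tiling at `Θ ≡ π/2` (unit squares: `Endpoints.colShift_sq`) -/

/-- The midpoint of each side of the unit square `f` is at distance `1/2` from its centre
`planeCorner f + (1 + i)/2`. [folklore] -/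
theorem norm_planeMidpoint_side_sub (f : Face) (sd : Side) :
    ‖planeMidpoint (fun (_ : ℤ) => Real.pi / 2) (f.side sd) - (planeCorner (fun (_ : ℤ) => Real.pi / 2) f + (1 + I) / 2)‖ = 1 / 2 := by
  obtain ⟨k, j⟩ := f
  cases sd with
  | W =>
    rw [show planeMidpoint (fun (_ : ℤ) => Real.pi / 2) (Face.side (k, j) Side.W) - (planeCorner (fun (_ : ℤ) => Real.pi / 2) (k, j) + (1 + I) / 2) =
      -(1 / 2 : ℂ) by simp only [Face.side, planeMidpoint]; ring]
    simp
  | E =>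
    rw [show planeMidpoint (fun (_ : ℤ) => Real.pi / 2) (Face.side (k, j) Side.E) - (planeCorner (fun (_ : ℤ) => Real.pi / 2) (k, j) + (1 + I) / 2) =
      (1 / 2 : ℂ) by simp only [Face.side, planeMidpoint, planeCorner_add_one_fst, Endpoints.colShift_sq]; ring]
    simp
  | S =>
    rw [show planeMidpoint (fun (_ : ℤ) => Real.pi / 2) (Face.side (k, j) Side.S) - (planeCorner (fun (_ : ℤ) => Real.pi / 2) (k, j) + (1 + I) / 2) =
      -(I / 2) by simp only [Face.side, planeMidpoint, Endpoints.colShift_sq]; ring]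
    simp
  | N =>
    rw [show planeMidpoint (fun (_ : ℤ) => Real.pi / 2) (Face.side (k, j) Side.N) - (planeCorner (fun (_ : ℤ) => Real.pi / 2) (k, j) + (1 + I) / 2) =
      I / 2 by simp only [Face.side, planeMidpoint, planeCorner_add_one_snd, Endpoints.colShift_sq]; ring]
    simp

/-- The four directions are unit vectors. [folklore] -/
@[simp] theorem norm_compassDir (i : Fin 4) : ‖compassDir i‖ = 1 := by
  fin_cases i <;> simp [compassDir]

/-- Every gadget vertex is embedded within `1/2` of the centre of its face. [folklore] -/
theorem norm_compassEmb_inr_sub_le (f : Face) (l : Fin 3) (i : Fin 4) :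
    ‖compassEmb (Sum.inr (f, l, i)) - (planeCorner (fun (_ : ℤ) => Real.pi / 2) f + (1 + I) / 2)‖ ≤ 1 / 2 := by
  simp only [compassEmb, add_sub_cancel_left]
  split_ifs with h0 h1
  · rw [norm_mul, norm_compassDir]
    norm_num
  · calc ‖(1 / 4 : ℂ) * (compassDir i + compassDir (i + 1))‖
        ≤ ‖(1 / 4 : ℂ)‖ * (‖compassDir i‖ + ‖compassDir (i + 1)‖) := by
          rw [norm_mul]
          gcongr
          exact norm_add_le _ _
      _ ≤ 1 / 2 := by rw [norm_compassDir, norm_compassDir]; norm_num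
  · calc ‖(1 / 8 : ℂ) * (compassDir i + compassDir (i + 1))‖
        ≤ ‖(1 / 8 : ℂ)‖ * (‖compassDir i‖ + ‖compassDir (i + 1)‖) := by
          rw [norm_mul]
          gcongr
          exact norm_add_le _ _
      _ ≤ 1 / 2 := by rw [norm_compassDir, norm_compassDir]; norm_num

/-- **Each gadget lies inside its face**: a gadget vertex of `f` is within distance `1` of the
midpoint of every side of `f`. [folklore] -/
theorem dist_compassEmb_inr_planeMidpoint_le (f : Face) (l : Fin 3) (i : Fin 4) (sd : Side) :
    dist (compassEmb (Sum.inr (f, l, i))) (planeMidpoint (fun (_ : ℤ) => Real.pi / 2) (f.side sd)) ≤ 1 := by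
  rw [dist_eq_norm]
  have h1 := norm_compassEmb_inr_sub_le f l i
  have h2 := norm_planeMidpoint_side_sub f sd
  calc ‖compassEmb (Sum.inr (f, l, i)) - planeMidpoint (fun (_ : ℤ) => Real.pi / 2) (f.side sd)‖
      = ‖(compassEmb (Sum.inr (f, l, i)) - (planeCorner (fun (_ : ℤ) => Real.pi / 2) f + (1 + I) / 2)) -
          (planeMidpoint (fun (_ : ℤ) => Real.pi / 2) (f.side sd) - (planeCorner (fun (_ : ℤ) => Real.pi / 2) f + (1 + I) / 2))‖ := by
        congr 1
        ring
    _ ≤ ‖compassEmb (Sum.inr (f, l, i)) - (planeCorner (fun (_ : ℤ) => Real.pi / 2) f + (1 + I) / 2)‖ +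
          ‖planeMidpoint (fun (_ : ℤ) => Real.pi / 2) (f.side sd) - (planeCorner (fun (_ : ℤ) => Real.pi / 2) f + (1 + I) / 2)‖ := norm_sub_le _ _
    _ ≤ 1 / 2 + 1 / 2 := add_le_add h1 h2.le
    _ = 1 := by norm_num

/-! ### Along a compass walk: the last port seen is a side of the current face -/

/-- **The coupling, vertex by vertex.** Along an adjacency chain `u :: t` of the compass graph,
if the "last port seen" `e` at `u` is `u` itself (when `u` is a port) or a side of the face of
`u` (when `u` is a gadget vertex), then every vertex of `t` is embedded within distance `1` of
the midpoint of the last port seen before or at it — the list `stay (midpoint e) …`. [folklore] -/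
theorem forall₂_support_stay (t : List CVert) : ∀ (e : MidEdge) (u : CVert),
    List.IsChain compassGraph.Adj (u :: t) → (∀ e', u = Sum.inl e' → e' = e) →
    (∀ f q, u = Sum.inr (f, q) → ∃ sd, f.side sd = e) →
    List.Forall₂ (fun v w => dist (compassEmb v) w ≤ 1) t
      (stay (planeMidpoint (fun (_ : ℤ) => Real.pi / 2) e) (t.map fun v => (Sum.getLeft? v).map (planeMidpoint (fun (_ : ℤ) => Real.pi / 2)))) := by
  induction t with
  | nil => intros; exact List.Forall₂.nil
  | cons v t ih =>
    intro e u hchain hinl hinr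
    obtain ⟨huv, ht⟩ := List.isChain_cons_cons.1 hchain
    rcases v with e' | ⟨f, l, i⟩
    · simp only [List.map_cons, Sum.getLeft?_inl, Option.map_some, stay_cons_some]
      refine List.Forall₂.cons ?_ (ih e' (Sum.inl e') ht
        (fun e'' h => (Sum.inl_injective h).symm) (fun f q h => absurd h Sum.inl_ne_inr))
      simp [compassEmb]
    · simp only [List.map_cons, Sum.getLeft?_inr, Option.map_none, stay_cons_none]
      have hside : ∃ sd, f.side sd = e := by
        rcases u with e'' | ⟨f', q'⟩
        · obtain rfl := hinl e'' rfl
          exact ⟨_, (eq_side_of_adj_inl_inr huv).2⟩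
        · obtain ⟨sd, hsd⟩ := hinr f' q' rfl
          exact ⟨sd, fst_eq_of_adj_inr_inr huv ▸ hsd⟩
      obtain ⟨sd, hsd⟩ := hside
      refine List.Forall₂.cons ?_ (ih e (Sum.inr (f, l, i)) ht
        (fun e'' h => absurd h Sum.inr_ne_inl) ?_)
      · rw [← hsd]
        exact dist_compassEmb_inr_planeMidpoint_le f l i sd
      · rintro f' q' h
        cases h
        exact ⟨sd, hsd⟩

/-- `map`/`filterMap` bookkeeping: the images of the selected entries are the `reduceOption` of
the list of optional images. [folklore] -/
theorem map_filterMap_eq_reduceOption {ι κ E : Type*} (g : ι → Option κ) (f : κ → E) :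
    ∀ t : List ι, (t.filterMap g).map f = (t.map fun v => (g v).map f).reduceOption
  | [] => rfl
  | v :: t => by
    rw [List.filterMap_cons, List.map_cons]
    cases h : g v with
    | none => rw [Option.map_none, List.reduceOption_cons_of_none]; exact map_filterMap_eq_reduceOption g f t
    | some x =>
      rw [List.map_cons, Option.map_some, List.reduceOption_cons_of_some,
        map_filterMap_eq_reduceOption g f t]

/-- **The O(δ) coupling.** A compass path of `Ω_δ` drawn at mesh `δ` and the drawing at mesh `δ`
of the Yang–Baxter walk through the same ports are at distance `≤ |δ|` in `CurveClass ℂ`.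
[folklore] -/
theorem dist_compassCurve_curve_le {Ω : Set ℂ} {δ : ℝ} {a b : MidEdge} (p : CPath Ω δ a b)
    (γ : YangBaxterSAW (fun (_ : ℤ) => Real.pi / 2) Ω δ a b) (hγ : γ.mids = ports p.1) :
    dist (compassCurve δ p) (γ.curve (fun (_ : ℤ) => Real.pi / 2) δ) ≤ |δ| := by
  set m : MidEdge → ℂ := planeMidpoint (fun (_ : ℤ) => Real.pi / 2) with hm
  set pt : MidEdge → ℂ := fun e => (δ : ℂ) * m e with hpt
  have hsupp : p.1.support = Sum.inl a :: p.1.support.tail := p.1.cons_tail_support.symm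
  set t : List CVert := p.1.support.tail with ht
  -- the YB curve is the polyline through the ports, repeated along the gadget blocks
  have hQ : γ.curve (fun (_ : ℤ) => Real.pi / 2) δ = CurveClass.mk
      ⟨polyline (pt a :: stay (pt a) (t.map fun v => (Sum.getLeft? v).map pt))⟩ := by
    rw [mk_polyline_stay, ← map_filterMap_eq_reduceOption]
    unfold YBWalk.curve YBWalk.path YBWalk.points
    rw [hγ, ports, hsupp,
      List.filterMap_cons_some (show Sum.getLeft? (Sum.inl a : CVert) = some a from rfl),
      List.map_cons]
  rw [hQ]
  unfold compassCurve SimpleGraph.Walk.toCurve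
  rw [hsupp, List.map_cons]
  refine dist_mk_polyline_le (abs_nonneg δ) (List.Forall₂.cons ?_ ?_)
  · simp [compassEmb, hpt, hm]
  · have h := forall₂_support_stay t a (Sum.inl a) (hsupp ▸ p.1.isChain_adj_support)
      (fun e' h => (Sum.inl_injective h).symm) (fun f q h => absurd h Sum.inl_ne_inr)
    have hstay : stay (pt a) (t.map fun v => (Sum.getLeft? v).map pt) =
        (stay (m a) (t.map fun v => (Sum.getLeft? v).map m)).map fun x => (δ : ℂ) * x := by
      rw [map_stay, List.map_map]
      congr 1
      refine List.map_congr_left fun v _ => ?_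
      simp only [Function.comp_apply, Option.map_map, hpt]
      rfl
    rw [hstay, List.forall₂_map_left_iff, List.forall₂_map_right_iff]
    refine h.imp fun {v x} hvx => ?_
    rw [dist_eq_norm, ← mul_sub, norm_mul, Complex.norm_real, Real.norm_eq_abs, ← dist_eq_norm]
    exact mul_le_of_le_one_right (abs_nonneg δ) hvx

end PortTransfer

open MeasureTheory Filter Topology Set
open Literature.Probability.RandomPlanarGeometry.SAW.YangBaxter Literature.Probability.RandomPlanarGeometry
open Summit.CriticalPhenomena.SAWScalingLimit.Theses
open PortTransfer

/-! ### Assembly -/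


/-- **Port transfer** (stub `stub_portTransfer` of the line `Sketch` for the crux `HexTransfer`,
stmt-CriticalPhenomena-14221): under the port dictionary, the compass chordal law and GM's
`ybLaw (π/2)` are push-forwards of one path measure along two drawings at distance `≤ |δ|`
(same port sequence; each gadget lies in its face), the total masses agree, hence
`ConvergesInLawToSLE (8/3)` transfers from `YBSquareSLE` to `CompassSLE` (bounded-Lipschitz
portmanteau). [folklore] -/
theorem stub_portTransfer :
    SAWCompassLattice.PortDictionary → SAWCompassLattice.YBSquareSLE →
      SAWCompassLattice.CompassSLE := by
  intro hP hY α β s z hsol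
  change ∀ (D : DobrushinDomain) (a b : ℝ → MidEdge),
    IsYBEndpointApprox (fun (_ : ℤ) => Real.pi / 2) D a b →
      ConvergesInLawToSLE ((8 : NNReal) / 3) D (fun (_ : ℝ) (x : CurveClass ℂ) => x)
        (fun δ => compassLaw α β s z D.carrier δ (a δ) (b δ))
  intro D a b hab
  obtain ⟨Γ, hΓ, -, hT⟩ := hY D a b hab
  haveI := isProbabilityMeasure_preWienerMeasure'
  refine ⟨Γ, hΓ, Eventually.of_forall fun δ => aemeasurable_id, ?_⟩
  -- GM's side, rewritten as the law of `curve ∘ toYB` under the compass path measure `ρ_δ`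
  have hT' : TendstoLaw
      (fun δ (p : CPath D.carrier δ (a δ) (b δ)) => (toYB hP hsol p).curve (fun (_ : ℤ) => Real.pi / 2) δ)
      (fun δ => compassRho α β s z D.carrier δ (a δ) (b δ)) Γ Literature.Probability.Process.preWienerMeasure := by
    intro f
    refine (hT f).congr fun δ => ?_
    change ∫ γ, f (γ.curve (fun (_ : ℤ) => Real.pi / 2) δ)
        ∂(ybLaw (fun (_ : ℤ) => Real.pi / 2) D.carrier δ 1 (a δ) (b δ)) = _
    rw [ybLaw_eq_map hP hsol, integral_map (measurable_cpath _).aemeasurable]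
    exact (YBWalk.measurable_of_top _).aestronglyMeasurable
  -- transfer along the O(δ) coupling
  have hε : Tendsto (fun δ : ℝ => |δ|) (𝓝[>] 0) (𝓝 0) :=
    (continuous_abs.tendsto' (0 : ℝ) 0 abs_zero).mono_left nhdsWithin_le_nhds
  have hT'' := tendstoLaw_of_dist_le
    (Y := fun δ (p : CPath D.carrier δ (a δ) (b δ)) => compassCurve δ p)
    (fun δ => compassRho_zero_or_prob α β s z D.carrier δ (a δ) (b δ))
    (fun δ => (measurable_cpath _).aemeasurable) (fun δ => (measurable_cpath _).aemeasurable)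
    hΓ.aemeasurable hε (fun δ p => dist_compassCurve_curve_le p _ (toYB_mids hP hsol p)) hT'
  -- back to the compass law on curves
  intro f
  refine (hT'' f).congr fun δ => ?_
  change _ = ∫ x, f x ∂(compassLaw α β s z D.carrier δ (a δ) (b δ))
  rw [compassLaw_eq_map, integral_map (measurable_cpath _).aemeasurable
    f.continuous.aestronglyMeasurable]

end Summit.CriticalPhenomena.SAWScalingLimit.Cruxes.HexTransfer.Sketch

end
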